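import Mathlib
import Summits.Ventures.PercRepro2.Defs
import Summits.Ventures.PercRepro2.Independence
import Summits.Ventures.PercRepro2.Harris
import Summits.Ventures.PercRepro2.Graph
import Summits.Ventures.PercRepro2.Exploration
import Summits.Ventures.PercRepro2.Events
import Summits.Ventures.PercRepro2.FourFunctions
import Summits.Ventures.PercRepro2.Induced
import Summits.Ventures.PercRepro2.Frontier
import Summits.Ventures.PercRepro2.ObsIndependence
import Summits.Ventures.PercRepro2.BHK
import Summits.Ventures.PercRepro2.BHKEvents
import Summits.Ventures.PercRepro2.VdBKahn
import Summits.Ventures.PercRepro2.BHKAvoid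
import Summits.Ventures.PercRepro2.R2PrimeThreeReduction
import Summits.Ventures.PercRepro2.YBridge
import Summits.Ventures.PercRepro2.Yu1Functionals

/-!
# STEP₀: the crux with `a₃` removed (blind cell PercRepro2, typer-1; lead g7 ADDENDUM 17 (13)(3),
INBOX 2026-08-23T00:40:13Z)

On `Q = {a₁ ↮ a₂}` (`avoidAll a₂ {a₁}`), for a vertex `v` and the marked vertex `b`:

  **`P(Q, b ∈ C₂) · [P(Q, v ∈ C₁) + P(Q, v ∈ C₂)] ≥ P(Q) · [P(Q, b ∈ C₂, v ∈ C₁) + P(Q, b ∈ C₁, v ∈ C₂)]`**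

under the labelling `P(b ↔ a₁) ≤ P(b ↔ a₂)` (`step0`; `step0_inU` with `v ∈ C₁ ∪ C₂`).  This is the
base step `∅ → {v}` of the monotone light-density family of ADDENDUM 17 (13) — the (ZΔ) crux with
`a₃` removed — and a two-line theorem: explore the heavy cluster `S = C(a₂)` on `Q`; `x = 1_{b∈S}`,
`y = 1_{v∈S}` are increasing, `β_l(S) = P_{G∖S}(b ∈ C(a₁))`, `γ_l(S) = P_{G∖S}(v ∈ C(a₁))` decreasing;
BHK 1.3 twice (`P(Q) E[x γ_l; Q] ≤ E[x; Q] E[γ_l; Q]`, `P(Q) E[y β_l; Q] ≤ E[y; Q] E[β_l; Q]`) and the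
labelling in the form `E[β_l; Q] = P(Q, b ∈ C₁) ≤ P(Q, b ∈ C₂) = E[x; Q]`
(`prob_conn_sub_eq_Q`: `P(b ↔ a₂) − P(b ↔ a₁) = P(Q, b ∈ C₂) − P(Q, b ∈ C₁)`); add.
-/

namespace Summit.Ventures.PercRepro2

open UnionCluster Yu1

namespace Step0

section Towers

variable {V : Type*} {E : Type*} [Fintype E] [DecidableEq E] [Fintype V] [DecidableEq V]
  {R : Type*} [Field R] [LinearOrder R] [IsStrictOrderedRing R]

omit [Fintype E] [DecidableEq E] [Fintype V] [DecidableEq V] in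
/-- `{b ∈ C₂} ∩ {v ∈ C₁} ∩ Q` as a two-cluster event of the heavy exploration. -/
lemma bv_event_eq (ends : E → Sym2 V) (a₁ a₂ v b : V) :
    clusterInEvent ends a₂ {W | b ∈ W} ∩ clusterInEvent ends a₁ {W | v ∈ W} ∩ avoidAll ends a₂ {a₁} =
      connEvent ends a₂ b ∩ connEvent ends a₁ v ∩ avoidAll ends a₂ {a₁} := by
  ext ω
  simp [clusterInEvent]

omit [Fintype E] [DecidableEq E] [Fintype V] [DecidableEq V] in
/-- `{v ∈ C₁} ∩ Q` (`C₂ ∈ univ`). -/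
lemma v1_event_eq (ends : E → Sym2 V) (a₁ a₂ v : V) :
    clusterInEvent ends a₂ Set.univ ∩ clusterInEvent ends a₁ {W | v ∈ W} ∩ avoidAll ends a₂ {a₁} =
      connEvent ends a₁ v ∩ avoidAll ends a₂ {a₁} := by
  ext ω
  simp [clusterInEvent]

omit [DecidableEq V] [LinearOrder R] [IsStrictOrderedRing R] in
/-- Tower: `P(Q, b ∈ C₂, v ∈ C₁) = E[1_b(S) γ_l(S); Q]`, `S = C(a₂)`, `γ_l = β(a₁, v)`. -/
lemma tower_bv (p : E → R) (ends : E → Sym2 V) (a₁ a₂ v b : V) :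
    prob p (connEvent ends a₂ b ∩ connEvent ends a₁ v ∩ avoidAll ends a₂ {a₁}) =
      expect p (fun ω => ind b (cluster ends ω a₂) * beta p ends a₁ v (cluster ends ω a₂) *
        (avoidAll ends a₂ {a₁}).indicator 1 ω) := by
  rw [← bv_event_eq, prob_clusterIn_inter_avoid_eq_expect p ends a₂ a₁ (X := {a₁})
    (Finset.mem_singleton_self a₁)]
  rfl

omit [DecidableEq V] [LinearOrder R] [IsStrictOrderedRing R] in
/-- Tower: `P(Q, v ∈ C₁) = E[γ_l(S); Q]`. -/
lemma tower_v1 (p : E → R) (ends : E → Sym2 V) (a₁ a₂ v : V) :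
    prob p (connEvent ends a₁ v ∩ avoidAll ends a₂ {a₁}) =
      expect p (fun ω => beta p ends a₁ v (cluster ends ω a₂) *
        (avoidAll ends a₂ {a₁}).indicator 1 ω) := by
  rw [← v1_event_eq, prob_clusterIn_inter_avoid_eq_expect p ends a₂ a₁ (X := {a₁})
    (Finset.mem_singleton_self a₁)]
  unfold beta
  simp only [Set.indicator_univ, Pi.one_apply, one_mul]

omit [Fintype V] [DecidableEq V] [LinearOrder R] [IsStrictOrderedRing R] in
/-- Tower: `P(Q, v ∈ C₂) = E[1_v(S); Q]`. -/
lemma tower_v2 (p : E → R) (ends : E → Sym2 V) (a₁ a₂ v : V) :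
    prob p (connEvent ends a₂ v ∩ avoidAll ends a₂ {a₁}) =
      expect p (fun ω => ind v (cluster ends ω a₂) * (avoidAll ends a₂ {a₁}).indicator 1 ω) := by
  rw [prob_eq_expect_indicator]
  unfold expect
  refine Finset.sum_congr rfl fun ω _ => ?_
  congr 1
  rw [indicator_inter_one]
  rfl

omit [Fintype E] [DecidableEq E] [Fintype V] [DecidableEq V] in
/-- On `Qᶜ = {a₁ ↔ a₂}`, `b ∈ C₂` and `b ∈ C₁` coincide. -/
lemma conn_b_inter_notQ (ends : E → Sym2 V) (a₁ a₂ b : V) :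
    connEvent ends a₂ b ∩ (avoidAll ends a₂ {a₁})ᶜ = connEvent ends a₁ b ∩ (avoidAll ends a₂ {a₁})ᶜ := by
  ext ω
  simp only [Set.mem_inter_iff, mem_connEvent, Set.mem_compl_iff, avoidAll, Set.mem_setOf_eq,
    Finset.mem_singleton, forall_eq, not_not]
  constructor
  · rintro ⟨hb, h21⟩
    exact ⟨conn_trans (conn_symm h21) hb, h21⟩
  · rintro ⟨hb, h21⟩
    exact ⟨conn_trans h21 hb, h21⟩

omit [Fintype V] [DecidableEq V] [LinearOrder R] [IsStrictOrderedRing R] in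
/-- **The labelling lives on `Q`**: `P(b ↔ a₂) − P(b ↔ a₁) = P(Q, b ∈ C₂) − P(Q, b ∈ C₁)`. -/
lemma prob_conn_sub_eq_Q (p : E → R) (ends : E → Sym2 V) (a₁ a₂ b : V) :
    prob p (connEvent ends a₂ b) - prob p (connEvent ends a₁ b) =
      prob p (connEvent ends a₂ b ∩ avoidAll ends a₂ {a₁}) -
        prob p (connEvent ends a₁ b ∩ avoidAll ends a₂ {a₁}) := by
  have s2 := prob_inter_add_prob_inter_compl p (connEvent ends a₂ b) (avoidAll ends a₂ {a₁})
  have s1 := prob_inter_add_prob_inter_compl p (connEvent ends a₁ b) (avoidAll ends a₂ {a₁})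
  rw [conn_b_inter_notQ] at s2
  linear_combination -s2 + s1

end Towers

section Main

variable {V : Type*} {E : Type*} [Fintype E] [DecidableEq E] [Fintype V] [DecidableEq V]
  {R : Type*} [Field R] [LinearOrder R] [IsStrictOrderedRing R]

/-- BHK 1.3 on the heavy exploration (`s = a₂`, `X = {a₁}`): for `w, z ∈ V`,
`P(Q) · E[1_w(S) β(a₁, z)(S); Q] ≤ E[1_w(S); Q] · E[β(a₁, z)(S); Q]`
(`1_w` increasing, `β(a₁, z)` decreasing). -/
lemma bhk_heavy (p : E → R) (hp : IsProbVec p) (ends : E → Sym2 V) (a₁ a₂ w z : V) :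
    prob p (avoidAll ends a₂ {a₁}) *
        expect p (fun ω => ind w (cluster ends ω a₂) * beta p ends a₁ z (cluster ends ω a₂) *
          (avoidAll ends a₂ {a₁}).indicator 1 ω) ≤
      expect p (fun ω => ind w (cluster ends ω a₂) * (avoidAll ends a₂ {a₁}).indicator 1 ω) *
        expect p (fun ω => beta p ends a₁ z (cluster ends ω a₂) *
          (avoidAll ends a₂ {a₁}).indicator 1 ω) := by
  have h := bhk_induced p hp ends a₂ (F₁ := (ind w : Set V → R))
    (F₂ := fun W => 1 - beta p ends a₁ z W) (ind_mono w)
    (fun W W' hW => sub_le_sub_left (beta_anti p hp ends a₁ z hW) 1) (ind_nonneg w)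
    (fun W => sub_nonneg.2 (beta_le_one p hp ends a₁ z W))
    Finset.univ {a₁} {a₁} (Finset.subset_univ _) (Finset.subset_univ _)
  simp only [REvent_univ, Finset.inter_self, Finset.union_self, expect_clusterObs_univ,
    Pi.mul_apply] at h
  have e1 : expect p (fun ω => (1 - beta p ends a₁ z (cluster ends ω a₂)) *
      (avoidAll ends a₂ {a₁}).indicator 1 ω) =
      prob p (avoidAll ends a₂ {a₁}) - expect p (fun ω => beta p ends a₁ z (cluster ends ω a₂) *
        (avoidAll ends a₂ {a₁}).indicator 1 ω) := by
    rw [prob_eq_expect_indicator, ← expect_sub]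
    congr 1
    funext ω
    simp only [Pi.sub_apply]
    ring
  have e2 : expect p (fun ω => ind w (cluster ends ω a₂) *
      (1 - beta p ends a₁ z (cluster ends ω a₂)) * (avoidAll ends a₂ {a₁}).indicator 1 ω) =
      expect p (fun ω => ind w (cluster ends ω a₂) * (avoidAll ends a₂ {a₁}).indicator 1 ω) -
      expect p (fun ω => ind w (cluster ends ω a₂) * beta p ends a₁ z (cluster ends ω a₂) *
        (avoidAll ends a₂ {a₁}).indicator 1 ω) := by
    rw [← expect_sub]
    congr 1
    funext ω
    simp only [Pi.sub_apply]
    ring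
  rw [e1, e2] at h
  nlinarith [h]

/-- **STEP₀** (ADDENDUM 17 (13)(3)): under the labelling `P(b ↔ a₁) ≤ P(b ↔ a₂)`,
`P(Q) · [P(Q, b ∈ C₂, v ∈ C₁) + P(Q, b ∈ C₁, v ∈ C₂)] ≤ P(Q, b ∈ C₂) · [P(Q, v ∈ C₁) + P(Q, v ∈ C₂)]`,
`Q = {a₁ ↮ a₂}`. -/
theorem step0 (p : E → R) (hp : IsProbVec p) (ends : E → Sym2 V) {a₁ a₂ v b : V}
    (hord : prob p (connEvent ends a₁ b) ≤ prob p (connEvent ends a₂ b)) :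
    prob p (avoidAll ends a₂ {a₁}) *
        (prob p (connEvent ends a₂ b ∩ connEvent ends a₁ v ∩ avoidAll ends a₂ {a₁}) +
          prob p (connEvent ends a₂ v ∩ connEvent ends a₁ b ∩ avoidAll ends a₂ {a₁})) ≤
      prob p (connEvent ends a₂ b ∩ avoidAll ends a₂ {a₁}) *
        (prob p (connEvent ends a₁ v ∩ avoidAll ends a₂ {a₁}) +
          prob p (connEvent ends a₂ v ∩ avoidAll ends a₂ {a₁})) := by
  -- the labelling on `Q`
  have hQ : prob p (connEvent ends a₁ b ∩ avoidAll ends a₂ {a₁}) ≤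
      prob p (connEvent ends a₂ b ∩ avoidAll ends a₂ {a₁}) := by
    have := prob_conn_sub_eq_Q p ends a₁ a₂ b
    linarith
  have hv2 : 0 ≤ prob p (connEvent ends a₂ v ∩ avoidAll ends a₂ {a₁}) := prob_nonneg hp _
  -- the two BHK steps, in probability form
  have h1 := bhk_heavy p hp ends a₁ a₂ b v
  have h2 := bhk_heavy p hp ends a₁ a₂ v b
  rw [← tower_bv, ← tower_v2, ← tower_v1] at h1
  rw [← tower_bv, ← tower_v2, ← tower_v1] at h2
  -- `E[y] · E[β_l] ≤ E[y] · E[x]` by the labelling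
  have h3 : prob p (connEvent ends a₂ v ∩ avoidAll ends a₂ {a₁}) *
      prob p (connEvent ends a₁ b ∩ avoidAll ends a₂ {a₁}) ≤
      prob p (connEvent ends a₂ v ∩ avoidAll ends a₂ {a₁}) *
        prob p (connEvent ends a₂ b ∩ avoidAll ends a₂ {a₁}) :=
    mul_le_mul_of_nonneg_left hQ hv2
  nlinarith [h1, h2, h3]

omit [Fintype E] [DecidableEq E] [Fintype V] [DecidableEq V] in
/-- On `Q`, `{v ∈ C₁}` and `{v ∈ C₂}` are disjoint. -/
lemma disjoint_v_on_Q (ends : E → Sym2 V) (a₁ a₂ v : V) :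
    Disjoint (connEvent ends a₁ v ∩ avoidAll ends a₂ {a₁})
      (connEvent ends a₂ v ∩ avoidAll ends a₂ {a₁}) := by
  rw [Set.disjoint_left]
  rintro ω ⟨h1, hQ⟩ ⟨h2, _⟩
  simp only [avoidAll, Set.mem_setOf_eq, Finset.mem_singleton, forall_eq] at hQ
  exact hQ (conn_trans (mem_connEvent.1 h2) (conn_symm (mem_connEvent.1 h1)))

omit [Fintype E] [DecidableEq E] [Fintype V] [DecidableEq V] in
/-- `{v ∈ C₁ ∪ C₂} ∩ Q` splits. -/
lemma inU_inter_Q_eq (ends : E → Sym2 V) (a₁ a₂ v : V) :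
    inU ends a₁ a₂ v ∩ avoidAll ends a₂ {a₁} =
      connEvent ends a₁ v ∩ avoidAll ends a₂ {a₁} ∪ connEvent ends a₂ v ∩ avoidAll ends a₂ {a₁} := by
  ext ω
  simp only [inU, Set.mem_inter_iff, Set.mem_union, mem_connEvent]
  constructor
  · rintro ⟨h | h, hQ⟩
    · exact Or.inl ⟨conn_symm h, hQ⟩
    · exact Or.inr ⟨conn_symm h, hQ⟩
  · rintro (⟨h, hQ⟩ | ⟨h, hQ⟩)
    · exact ⟨Or.inl (conn_symm h), hQ⟩
    · exact ⟨Or.inr (conn_symm h), hQ⟩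

/-- **STEP₀ with `v ∈ C₁ ∪ C₂`**: `P(Q, b ∈ C₂) · P(Q, v ∈ C₁ ∪ C₂) ≥ P(Q) · [P(Q, b ∈ C₂, v ∈ C₁) + P(Q, b ∈ C₁, v ∈ C₂)]`. -/
theorem step0_inU (p : E → R) (hp : IsProbVec p) (ends : E → Sym2 V) {a₁ a₂ v b : V}
    (hord : prob p (connEvent ends a₁ b) ≤ prob p (connEvent ends a₂ b)) :
    prob p (avoidAll ends a₂ {a₁}) *
        (prob p (connEvent ends a₂ b ∩ connEvent ends a₁ v ∩ avoidAll ends a₂ {a₁}) +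
          prob p (connEvent ends a₂ v ∩ connEvent ends a₁ b ∩ avoidAll ends a₂ {a₁})) ≤
      prob p (connEvent ends a₂ b ∩ avoidAll ends a₂ {a₁}) *
        prob p (inU ends a₁ a₂ v ∩ avoidAll ends a₂ {a₁}) := by
  rw [inU_inter_Q_eq, prob_union_of_disjoint p (disjoint_v_on_Q ends a₁ a₂ v)]
  exact step0 p hp ends hord

end Main

end Step0

end Summit.Ventures.PercRepro2
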